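import Mathlib
import Literature.Analysis.FluidPDE.TypeIICoreWitness
import Literature.Analysis.FluidPDE.SuitableWeak
import HarnessLib

/-!
# Cruxes `ColumnarCoreExclusion` (stmt-1966) / `MonopoleCoreExclusion` (stmt-1965): the residual of the anchor stubs
# (LATENESS and a CORE-RADIUS FLOOR) is NOT a consequence of the witness clauses — a kinematic obstruction

`--supports stmt-NavierStokesRegularity-1966` (helper file, negative side; theorems only, no definitions, no `sorry`;
outside the import cone of the route file).

The registered anchor stub `stub_anchoredLateColumnarWitness` (line `columnar_comparison_flow`) asks, from the crux
hypothesis `hw` ("level-`K` columnar core witnesses occur at every level `K > 0` frequently before `T`") plus the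
blow-up hypotheses, for witnesses that are LATE, `(T - t)·V ≤ K·L` (the core radius `K·L` contains the causal horizon
`(T - t)·V`), and ANCHORED at a singular point.  Hand 6-g2 proved (`CoreExclusionAnchor.anchoredLateWitness_of_
lateWitnesses_radiusFloor`, p831087) that late witnesses with a core-radius floor give the whole stub, and diagnosed
that lateness and the floor are not contained in `hw`.  THIS FILE MAKES THAT DIAGNOSIS A THEOREM at the level of the
witness vocabulary:

* `CoreExclusionAnchorObstruction.mul_sub_one_le_of_support` — **core radii of columnar witnesses are bounded by the
  support.**  If a slice `f : ℝ³ → ℝ³` vanishes outside `B̄(c, ρ)`, then every datum `(x₀, L, V, Q, W)` satisfying the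
  near-maximum clause and the level-`K` closeness clause to a COLUMNAR profile `W`, `K > 4`, has `L·(K - 1) ≤ 2ρ`
  (hence `K·L < 3ρ`, `coreRadius_lt_of_support`).  Proof: at the near-maximum point the profile has size `≥ 1/2 - 1/K`;
  columnarity transports this value `K - 1` core lengths along the axis `Q e_z`, where — if `L(K-1) > 2ρ` — the slice
  vanishes and closeness forces size `≤ 1/K`; `1/2 ≤ 2/K` contradicts `K > 4`.
* `CoreExclusionAnchorObstruction.exists_columnarWitnesses_never_late` — **an explicit family** `u : ℝ → ℝ³ → ℝ³`
  (NOT a Navier–Stokes solution: a compactly supported columnar core of length `ℓ(t) = (1-t)²`, speed `(1-t)⁻³`,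
  cut off at radius `(1-t)/3`) which (i) carries level-`K` columnar witnesses (`TypeIICoreWitness IsColumnar 1 K u t`)
  at every level `K > 0` frequently before `T = 1` — the hypothesis `hw` of the crux verbatim, with `ν = 1`; (ii) grows
  faster than the Type-I rate (`¬ IsTypeIBlowup u 1`); and yet (iii) at every time `0 < t < 1` EVERY level-`K` datum
  (`K > 4`) satisfying the near-maximum and columnar-closeness clauses has core radius `K·L ≤ 1 - t` (so no core-radius
  floor survives as `t ↑ 1`) and `K·L < (1 - t)·V` (so NO such witness is late); in particular (iv) the "late witnesses
  frequently" hypothesis of the 6-g2 reduction fails at level `5` although `hw` holds at every level.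

Consequence for the line (honest reading): any proof of the anchor stubs must use the Navier–Stokes dynamics / the
geometry of the singular set — lateness and the floor cannot be extracted from `hw`, the blow-up rate, or level
bookkeeping.  Nothing about Navier–Stokes regularity is claimed; no stub or crux is proved or refuted here (the stub's
hypotheses include a genuine blow-up, which this kinematic family is not).
-/

noncomputable section

open Set Metric Filter Topology
open Literature.Analysis Literature.Analysis.FluidPDE

namespace Summit.NavierStokesRegularity.NavierStokesRegularity.Theorems

-- the problem directory repeats the summit name (`NavierStokesRegularity/NavierStokesRegularity`)
set_option linter.dupNamespace false

namespace CoreExclusionAnchorObstruction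

/-! ### §1 Core radii of columnar witnesses of a compactly supported slice -/

/-- The axial unit vector has norm one: `‖e_z‖ = 1` (private copy; the tree has several file-local versions,
e.g. `LandauSolutions.norm_eZ'`). [folklore] -/
private theorem norm_eZ : ‖(eZ : EuclideanSpace ℝ (Fin 3))‖ = 1 := by
  simp [eZ]

/-- **Core lengths of columnar witnesses are bounded by the support of the slice.**  Let `f : ℝ³ → ℝ³` vanish outside
the closed ball `B̄(c, ρ)`.  If `(x₀, L, V, Q, W)` satisfies the near-maximum clause (`V ≤ 2‖f x₁‖` for some `x₁`
with `dist x₁ x₀ ≤ L`, `V > 0`) and the level-`K` closeness clause to a columnar profile `W`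
(`‖V⁻¹ Q⁻¹ f(x₀ + L Q y) - W y‖ ≤ K⁻¹` on `‖y‖ ≤ K`) with `K > 4`, then `L·(K - 1) ≤ 2ρ`.  (At
`y₁ = L⁻¹Q⁻¹(x₁ - x₀)`, `‖W y₁‖ ≥ 1/2 - 1/K`; by columnarity `W (y₁ + (K-1)e_z) = W y₁`, while the physical point
`x₁ + L(K-1)·Q e_z` lies outside `B̄(c,ρ)` when `L(K-1) > 2ρ`, where `f = 0` and closeness gives `‖W y₁‖ ≤ 1/K`.)
[folklore] -/
theorem mul_sub_one_le_of_support {f : EuclideanSpace ℝ (Fin 3) → EuclideanSpace ℝ (Fin 3)}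
    {c : EuclideanSpace ℝ (Fin 3)} {ρ : ℝ}
    (hsupp : ∀ x, f x ≠ 0 → dist x c ≤ ρ)
    {K L V : ℝ} {x₀ : EuclideanSpace ℝ (Fin 3)}
    {Q : EuclideanSpace ℝ (Fin 3) ≃ₗᵢ[ℝ] EuclideanSpace ℝ (Fin 3)}
    {W : EuclideanSpace ℝ (Fin 3) → EuclideanSpace ℝ (Fin 3)}
    (hK : 4 < K) (hL : 0 < L) (hV : 0 < V) (hW : IsColumnar W)
    (hnear : ∃ x₁, dist x₁ x₀ ≤ L ∧ V ≤ 2 * ‖f x₁‖)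
    (hclose : ∀ y : EuclideanSpace ℝ (Fin 3), ‖y‖ ≤ K →
      ‖V⁻¹ • Q.symm (f (x₀ + L • Q y)) - W y‖ ≤ K⁻¹) :
    L * (K - 1) ≤ 2 * ρ := by
  obtain ⟨x₁, hx₁, hVx₁⟩ := hnear
  have hK0 : 0 < K := by linarith
  have hKinv : K⁻¹ < 4⁻¹ := by
    rw [inv_lt_inv₀ hK0 (by norm_num : (0:ℝ) < 4)]; exact hK
  -- the near-maximum point lies in the support
  have hfx₁ : f x₁ ≠ 0 := by
    intro h
    rw [h, norm_zero, mul_zero] at hVx₁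
    exact absurd hVx₁ (not_le.2 hV)
  have hx₁c : dist x₁ c ≤ ρ := hsupp x₁ hfx₁
  -- rescaled position of the near-maximum point
  set y₁ : EuclideanSpace ℝ (Fin 3) := L⁻¹ • Q.symm (x₁ - x₀) with hy₁
  have hphys₁ : x₀ + L • Q y₁ = x₁ := by
    rw [hy₁, map_smul, smul_smul, mul_inv_cancel₀ hL.ne', one_smul, Q.apply_symm_apply]
    abel
  have hny₁ : ‖y₁‖ ≤ 1 := by
    rw [hy₁, norm_smul, Real.norm_of_nonneg (inv_nonneg.2 hL.le), LinearIsometryEquiv.norm_map,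
      ← dist_eq_norm]
    calc L⁻¹ * dist x₁ x₀ ≤ L⁻¹ * L := mul_le_mul_of_nonneg_left hx₁ (inv_nonneg.2 hL.le)
      _ = 1 := inv_mul_cancel₀ hL.ne'
  clear_value y₁
  -- the profile is large at `y₁`
  have hWy₁ : 2⁻¹ - K⁻¹ ≤ ‖W y₁‖ := by
    have h1 := hclose y₁ (hny₁.trans (by linarith))
    rw [hphys₁] at h1
    have h2 : ‖V⁻¹ • Q.symm (f x₁)‖ = V⁻¹ * ‖f x₁‖ := by
      rw [norm_smul, Real.norm_of_nonneg (inv_nonneg.2 hV.le), LinearIsometryEquiv.norm_map]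
    have h3 : 2⁻¹ ≤ V⁻¹ * ‖f x₁‖ := by
      rw [le_inv_mul_iff₀ hV]
      linarith
    linarith [norm_sub_norm_le (V⁻¹ • Q.symm (f x₁)) (W y₁)]
  -- suppose the core is long compared with the support: transport along the axis
  by_contra hcon
  push Not at hcon
  set τ : ℝ := K - 1 with hτ
  have hτ0 : 0 ≤ τ := by rw [hτ]; linarith
  set y₂ : EuclideanSpace ℝ (Fin 3) := y₁ + τ • eZ with hy₂
  have hny₂ : ‖y₂‖ ≤ K := by
    calc ‖y₂‖ ≤ ‖y₁‖ + ‖τ • (eZ : EuclideanSpace ℝ (Fin 3))‖ := norm_add_le _ _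
      _ ≤ 1 + τ := by
          rw [norm_smul τ (eZ : EuclideanSpace ℝ (Fin 3)), Real.norm_of_nonneg hτ0, norm_eZ, mul_one]
          exact add_le_add_left hny₁ _
      _ = K := by rw [hτ]; ring
  have hphys₂ : x₀ + L • Q y₂ = x₁ + (L * τ) • Q eZ := by
    rw [hy₂, map_add, map_smul, smul_add, smul_smul, ← add_assoc, hphys₁]
  -- the transported physical point is outside the support
  have hout : ρ < dist (x₁ + (L * τ) • Q eZ) c := by
    have hd : dist (x₁ + (L * τ) • Q eZ) x₁ = L * τ := by
      rw [dist_eq_norm, add_sub_cancel_left, norm_smul, LinearIsometryEquiv.norm_map, norm_eZ, mul_one,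
        Real.norm_of_nonneg (mul_nonneg hL.le hτ0)]
    have htri : dist (x₁ + (L * τ) • Q eZ) x₁ ≤ dist (x₁ + (L * τ) • Q eZ) c + dist c x₁ :=
      dist_triangle _ _ _
    rw [hd, dist_comm c x₁] at htri
    have hLτ : L * τ = L * (K - 1) := by rw [hτ]
    linarith
  have hf₂ : f (x₁ + (L * τ) • Q eZ) = 0 := by
    by_contra h
    exact absurd (hsupp _ h) (not_le.2 hout)
  -- closeness at `y₂` makes the profile small at `y₁`
  have hWsmall : ‖W y₁‖ ≤ K⁻¹ := by
    have h1 := hclose y₂ hny₂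
    rw [hphys₂, hf₂, map_zero, smul_zero, zero_sub, norm_neg] at h1
    have hcol : W y₂ = W y₁ := by rw [hy₂]; exact hW y₁ τ
    rwa [hcol] at h1
  -- `1/2 ≤ 2/K` contradicts `K > 4`
  linarith

/-- **Core radii of columnar witnesses are bounded by the support** (core-radius form of
`mul_sub_one_le_of_support`): under the same hypotheses, `K·L < 3ρ`. [folklore] -/
theorem coreRadius_lt_of_support {f : EuclideanSpace ℝ (Fin 3) → EuclideanSpace ℝ (Fin 3)}
    {c : EuclideanSpace ℝ (Fin 3)} {ρ : ℝ}
    (hsupp : ∀ x, f x ≠ 0 → dist x c ≤ ρ)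
    {K L V : ℝ} {x₀ : EuclideanSpace ℝ (Fin 3)}
    {Q : EuclideanSpace ℝ (Fin 3) ≃ₗᵢ[ℝ] EuclideanSpace ℝ (Fin 3)}
    {W : EuclideanSpace ℝ (Fin 3) → EuclideanSpace ℝ (Fin 3)}
    (hK : 4 < K) (hL : 0 < L) (hV : 0 < V) (hW : IsColumnar W)
    (hnear : ∃ x₁, dist x₁ x₀ ≤ L ∧ V ≤ 2 * ‖f x₁‖)
    (hclose : ∀ y : EuclideanSpace ℝ (Fin 3), ‖y‖ ≤ K →
      ‖V⁻¹ • Q.symm (f (x₀ + L • Q y)) - W y‖ ≤ K⁻¹) :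
    K * L < 3 * ρ := by
  have h := mul_sub_one_le_of_support hsupp hK hL hV hW hnear hclose
  -- `K L = L (K-1) · K/(K-1)` and `K/(K-1) < 4/3 < 3/2`
  nlinarith [mul_pos hL (by linarith : (0:ℝ) < K - 4)]

/-! ### §2 The profile of the kinematic family -/

/-- The cone profile `y ↦ max 0 (1 - r(y)) • e_z` (`r` the cylindrical radius) is columnar. [folklore] -/
theorem isColumnar_coneProfile :
    IsColumnar (fun y : EuclideanSpace ℝ (Fin 3) => max 0 (1 - cylRadius y) • (eZ : EuclideanSpace ℝ (Fin 3))) := by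
  intro y τ
  simp only [cylRadius, add_smul_eZ_apply_zero, add_smul_eZ_apply_one]

/-- The cone profile has norm at most one. [folklore] -/
theorem norm_coneProfile_le (y : EuclideanSpace ℝ (Fin 3)) :
    ‖max 0 (1 - cylRadius y) • (eZ : EuclideanSpace ℝ (Fin 3))‖ ≤ 1 := by
  rw [norm_smul, norm_eZ, mul_one, Real.norm_of_nonneg (le_max_left _ _)]
  exact max_le zero_le_one (by linarith [cylRadius_nonneg y])

/-- The cone profile at the origin is `e_z`. [folklore] -/
theorem coneProfile_zero :
    max 0 (1 - cylRadius (0 : EuclideanSpace ℝ (Fin 3))) • (eZ : EuclideanSpace ℝ (Fin 3)) = eZ := by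
  have h : cylRadius (0 : EuclideanSpace ℝ (Fin 3)) = 0 := by simp [cylRadius]
  rw [h, sub_zero, max_eq_right zero_le_one, one_smul]

/-- The cone profile vanishes at the horizontal unit vector `e_x`. [folklore] -/
theorem coneProfile_single_zero :
    max 0 (1 - cylRadius (EuclideanSpace.single (0 : Fin 3) (1 : ℝ))) • (eZ : EuclideanSpace ℝ (Fin 3)) = 0 := by
  have h : cylRadius (EuclideanSpace.single (0 : Fin 3) (1 : ℝ)) = 1 := by
    simp [cylRadius]
  rw [h, sub_self, max_self, zero_smul]

/-! ### §3 The kinematic family: witnesses at every level, never late, no radius floor -/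

/-- **Witness clauses do not force lateness or a core-radius floor** (kinematic obstruction for the anchor stubs of
cruxes `ColumnarCoreExclusion` / `MonopoleCoreExclusion`).  There is an explicit family `u : ℝ → ℝ³ → ℝ³` — at time
`t < 1`, with `s = 1 - t`: the columnar cone core `s⁻³ · max(0, 1 - r(x)/s²) e_z` cut off outside the ball
`‖x‖ ≤ s/3` (NOT a Navier–Stokes solution) — such that
(i) `u` carries level-`K` COLUMNAR core witnesses at viscosity `1` at every level `K > 0` frequently before `T = 1`
(the crux hypothesis `hw` verbatim); (ii) `u` grows faster than the Type-I rate, `¬ IsTypeIBlowup u 1`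
(`‖u(t,0)‖ = (1-t)⁻³`); (iii) for every `K > 4` and every time `0 < t < 1`, EVERY datum `(x₀, L, V, Q, W)` satisfying
the speed-bound, near-maximum and level-`K` columnar-closeness clauses has core radius `K·L ≤ 1 - t` (no floor) and
`K·L < (1 - t)·V` (not late); (iv) consequently the "late level-`5` witnesses frequently" statement fails.  So the
residual of the registered anchor stubs (lateness `(T-t)V ≤ KL` and a floor `r₀ ≤ KL`, cf.
`CoreExclusionAnchor.anchoredLateWitness_of_lateWitnesses_radiusFloor`) must come from the Navier–Stokes dynamics, not
from `hw` and rate bookkeeping. [folklore] -/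
theorem exists_columnarWitnesses_never_late :
    ∃ u : ℝ → EuclideanSpace ℝ (Fin 3) → EuclideanSpace ℝ (Fin 3),
      (∀ K : ℝ, 0 < K → ∀ t₀ < (1 : ℝ), ∃ t, t₀ < t ∧ t < 1 ∧ TypeIICoreWitness IsColumnar 1 K u t) ∧
      ¬ IsTypeIBlowup u 1 ∧
      (∀ (K t : ℝ), 4 < K → 0 < t → t < 1 →
        ∀ (x₀ : EuclideanSpace ℝ (Fin 3)) (L V : ℝ)
          (Q : EuclideanSpace ℝ (Fin 3) ≃ₗᵢ[ℝ] EuclideanSpace ℝ (Fin 3))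
          (W : EuclideanSpace ℝ (Fin 3) → EuclideanSpace ℝ (Fin 3)),
          0 < L → 0 < V → IsColumnar W → (∀ x, ‖u t x‖ ≤ V) →
          (∃ x₁, dist x₁ x₀ ≤ L ∧ V ≤ 2 * ‖u t x₁‖) →
          (∀ y : EuclideanSpace ℝ (Fin 3), ‖y‖ ≤ K →
            ‖V⁻¹ • Q.symm (u t (x₀ + L • Q y)) - W y‖ ≤ K⁻¹) →
          K * L ≤ 1 - t ∧ K * L < (1 - t) * V) ∧
      ¬ (∀ t₀ < (1 : ℝ), ∃ t, t₀ < t ∧ t < 1 ∧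
        ∃ (x₀ : EuclideanSpace ℝ (Fin 3)) (L V : ℝ)
          (Q : EuclideanSpace ℝ (Fin 3) ≃ₗᵢ[ℝ] EuclideanSpace ℝ (Fin 3))
          (W : EuclideanSpace ℝ (Fin 3) → EuclideanSpace ℝ (Fin 3)),
          0 < L ∧ 0 < V ∧ IsColumnar W ∧ (∀ x, ‖u t x‖ ≤ V) ∧
          (∃ x₁, dist x₁ x₀ ≤ L ∧ V ≤ 2 * ‖u t x₁‖) ∧
          (∃ y y' : EuclideanSpace ℝ (Fin 3), ‖y‖ ≤ 1 ∧ ‖y'‖ ≤ 1 ∧ (4 : ℝ)⁻¹ ≤ ‖W y - W y'‖) ∧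
          5 * (1 : ℝ) ≤ L * V ∧
          (∀ y : EuclideanSpace ℝ (Fin 3), ‖y‖ ≤ 5 →
            ‖V⁻¹ • Q.symm (u t (x₀ + L • Q y)) - W y‖ ≤ (5 : ℝ)⁻¹) ∧
          (1 - t) * V ≤ 5 * L) := by
  -- the profile and the family
  set G : EuclideanSpace ℝ (Fin 3) → EuclideanSpace ℝ (Fin 3) :=
    fun y => max 0 (1 - cylRadius y) • (eZ : EuclideanSpace ℝ (Fin 3)) with hG
  set u : ℝ → EuclideanSpace ℝ (Fin 3) → EuclideanSpace ℝ (Fin 3) :=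
    fun t x => if ‖x‖ ≤ (1 - t) / 3 then ((1 - t)⁻¹ ^ 3) • G (((1 - t) ^ 2)⁻¹ • x) else 0 with hu
  have hGle : ∀ y, ‖G y‖ ≤ 1 := fun y => norm_coneProfile_le y
  have hG0 : G 0 = eZ := coneProfile_zero
  have hGcol : IsColumnar G := isColumnar_coneProfile
  -- value at the origin and the global speed bound
  have hu0 : ∀ t < (1 : ℝ), u t 0 = ((1 - t)⁻¹ ^ 3) • (eZ : EuclideanSpace ℝ (Fin 3)) := by
    intro t ht
    have h : ‖(0 : EuclideanSpace ℝ (Fin 3))‖ ≤ (1 - t) / 3 := by rw [norm_zero]; linarith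
    simp only [hu, if_pos h, smul_zero, hG0]
  have hnorm0 : ∀ t < (1 : ℝ), ‖u t 0‖ = (1 - t)⁻¹ ^ 3 := by
    intro t ht
    rw [hu0 t ht, norm_smul, norm_eZ, mul_one, Real.norm_of_nonneg (by positivity)]
  have hbound : ∀ t < (1 : ℝ), ∀ x, ‖u t x‖ ≤ (1 - t)⁻¹ ^ 3 := by
    intro t ht x
    by_cases hx : ‖x‖ ≤ (1 - t) / 3
    · simp only [hu, if_pos hx]
      rw [norm_smul, Real.norm_of_nonneg (by positivity)]
      exact mul_le_of_le_one_right (by positivity) (hGle _)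
    · simp only [hu, if_neg hx, norm_zero]
      positivity
  have hsupp : ∀ t x, u t x ≠ 0 → dist x (0 : EuclideanSpace ℝ (Fin 3)) ≤ (1 - t) / 3 := by
    intro t x hx
    rw [dist_zero_right]
    by_contra h
    exact hx (by simp only [hu, if_neg h])
  -- exact columnarity on the ball `‖x‖ ≤ (1-t)/3`
  have hcore : ∀ t < (1 : ℝ), ∀ y : EuclideanSpace ℝ (Fin 3), ‖y‖ * (1 - t) ≤ 3⁻¹ →
      u t ((0 : EuclideanSpace ℝ (Fin 3)) + ((1 - t) ^ 2) • (LinearIsometryEquiv.refl ℝ _ y)) =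
        ((1 - t)⁻¹ ^ 3) • G y := by
    intro t ht y hy
    have hs : 0 < 1 - t := sub_pos.2 ht
    have hn : ‖((1 - t) ^ 2) • y‖ ≤ (1 - t) / 3 := by
      rw [norm_smul, Real.norm_of_nonneg (by positivity)]
      nlinarith
    simp only [LinearIsometryEquiv.coe_refl, id_eq, zero_add]
    simp only [hu, if_pos hn, smul_smul, inv_mul_cancel₀ (pow_ne_zero 2 hs.ne'), one_smul]
  refine ⟨u, ?_, ?_, ?_, ?_⟩
  · -- (i) witnesses at every level frequently before `1`
    intro K hK t₀ ht₀
    set t : ℝ := (max t₀ (1 - (6 * K)⁻¹) + 1) / 2 with ht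
    have hK6 : 0 < (6 * K)⁻¹ := by positivity
    have hmax_lt : max t₀ (1 - (6 * K)⁻¹) < 1 := max_lt ht₀ (by linarith)
    have ht₀t : t₀ < t := by
      have := le_max_left t₀ (1 - (6 * K)⁻¹); rw [ht]; linarith
    have ht1 : t < 1 := by rw [ht]; linarith
    have hs : 0 < 1 - t := sub_pos.2 ht1
    have hsK : (1 - t) ≤ (6 * K)⁻¹ := by
      have := le_max_right t₀ (1 - (6 * K)⁻¹); rw [ht]; linarith
    have hsK' : (1 - t) * K ≤ 6⁻¹ := by
      calc (1 - t) * K ≤ (6 * K)⁻¹ * K := mul_le_mul_of_nonneg_right hsK hK.le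
        _ = 6⁻¹ := by field_simp
    refine ⟨t, ht₀t, ht1, 0, (1 - t) ^ 2, (1 - t)⁻¹ ^ 3, LinearIsometryEquiv.refl ℝ _, G,
      by positivity, by positivity, hGcol, hbound t ht1, ?_, ?_, ?_, ?_⟩
    · refine ⟨0, by rw [dist_self]; positivity, ?_⟩
      rw [hnorm0 t ht1]; linarith [pow_pos (inv_pos.2 hs) 3]
    · refine ⟨0, EuclideanSpace.single 0 1, by simp, by simp, ?_⟩
      have hG1 : G (EuclideanSpace.single 0 1) = 0 := coneProfile_single_zero
      rw [hG0, hG1, sub_zero, norm_eZ]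
      norm_num
    · -- Reynolds: `K ≤ (1-t)² (1-t)⁻³ = (1-t)⁻¹`
      have h1 : (1 - t) ^ 2 * (1 - t)⁻¹ ^ 3 = (1 - t)⁻¹ := by field_simp
      rw [mul_one, h1, le_inv_comm₀ hK hs]
      exact hsK.trans (inv_anti₀ hK (by linarith))
    · intro y hy
      have hy' : ‖y‖ * (1 - t) ≤ 3⁻¹ := by
        calc ‖y‖ * (1 - t) ≤ K * (1 - t) := mul_le_mul_of_nonneg_right hy hs.le
          _ = (1 - t) * K := mul_comm _ _
          _ ≤ 6⁻¹ := hsK'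
          _ ≤ 3⁻¹ := by norm_num
      have hrefl : ∀ z : EuclideanSpace ℝ (Fin 3),
          (LinearIsometryEquiv.refl ℝ (EuclideanSpace ℝ (Fin 3))).symm z = z := fun z => rfl
      rw [hcore t ht1 y hy', hrefl, smul_smul,
        inv_mul_cancel₀ (by positivity : (1 - t)⁻¹ ^ 3 ≠ 0), one_smul, sub_self, norm_zero]
      positivity
  · -- (ii) faster than the Type-I rate at the origin
    rintro ⟨C, hC⟩
    obtain ⟨l, hl1, hsub⟩ := mem_nhdsLT_iff_exists_Ioo_subset.1 hC
    rw [mem_Iio] at hl1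
    set s : ℝ := min ((1 - l) / 2) (|C| + 2)⁻¹ with hsdef
    have hC2 : 0 < |C| + 2 := by positivity
    have hs0 : 0 < s := lt_min (by linarith) (inv_pos.2 hC2)
    have hsl : s ≤ (1 - l) / 2 := min_le_left _ _
    have hsC : s ≤ (|C| + 2)⁻¹ := min_le_right _ _
    have hs1 : s ≤ 1 := hsC.trans (inv_le_one_of_one_le₀ (by linarith [abs_nonneg C]))
    have hmem : 1 - s ∈ Ioo l 1 := ⟨by linarith, by linarith⟩
    have h : ‖u (1 - s) 0‖ ≤ C / Real.sqrt (1 - (1 - s)) := hsub hmem 0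
    rw [hnorm0 (1 - s) (by linarith)] at h
    simp only [sub_sub_cancel] at h
    have hsqrt : 0 < Real.sqrt s := Real.sqrt_pos.2 hs0
    have hsqrt_ge : s ≤ Real.sqrt s := by
      rw [Real.le_sqrt hs0.le hs0.le]
      nlinarith
    have h2 : s⁻¹ ^ 3 * Real.sqrt s ≤ C := by
      have := mul_le_mul_of_nonneg_right h hsqrt.le
      rwa [div_mul_cancel₀ _ hsqrt.ne'] at this
    have h3 : s⁻¹ ^ 2 ≤ C := by
      calc s⁻¹ ^ 2 = s⁻¹ ^ 3 * s := by field_simp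
        _ ≤ s⁻¹ ^ 3 * Real.sqrt s := mul_le_mul_of_nonneg_left hsqrt_ge (by positivity)
        _ ≤ C := h2
    have h4 : |C| + 2 ≤ s⁻¹ := by
      rw [le_inv_comm₀ hC2 hs0]
      exact hsC
    have h5 : (|C| + 2) ^ 2 ≤ s⁻¹ ^ 2 := pow_le_pow_left₀ hC2.le h4 2
    nlinarith [le_abs_self C, abs_nonneg C]
  · -- (iii) every level-`K` datum (`K > 4`) has small core radius and is not late
    intro K t hK ht0 ht1 x₀ L V Q W hL hV hW hbd hnear hclose
    have hs : 0 < 1 - t := sub_pos.2 ht1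
    have hs1 : 1 - t < 1 := by linarith
    have hKL : K * L < 3 * ((1 - t) / 3) :=
      coreRadius_lt_of_support (hsupp t) hK hL hV hW hnear hclose
    have hV' : (1 - t)⁻¹ ^ 3 ≤ V := by rw [← hnorm0 t ht1]; exact hbd 0
    refine ⟨by linarith, ?_⟩
    have h1 : (1 : ℝ) ≤ (1 - t)⁻¹ ^ 3 := one_le_pow₀ (one_le_inv_iff₀.2 ⟨hs, hs1.le⟩)
    have h2 : (1 - t) * 1 ≤ (1 - t) * V := mul_le_mul_of_nonneg_left (h1.trans hV') hs.le
    linarith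
  · -- (iv) no late level-`5` witnesses at any time after `0`
    intro hlate
    obtain ⟨t, ht0, ht1, x₀, L, V, Q, W, hL, hV, hW, hbd, hnear, -, -, hclose, hl⟩ := hlate 0 one_pos
    have hs : 0 < 1 - t := sub_pos.2 ht1
    have hKL : 5 * L < 3 * ((1 - t) / 3) :=
      coreRadius_lt_of_support (hsupp t) (by norm_num) hL hV hW hnear hclose
    have hV' : (1 - t)⁻¹ ^ 3 ≤ V := by rw [← hnorm0 t ht1]; exact hbd 0
    have h1 : (1 : ℝ) ≤ (1 - t)⁻¹ ^ 3 := one_le_pow₀ (one_le_inv_iff₀.2 ⟨hs, by linarith⟩)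
    have h2 : (1 - t) * 1 ≤ (1 - t) * V := mul_le_mul_of_nonneg_left (h1.trans hV') hs.le
    linarith

/-! ### §4 The Type-I window: where lateness IS free

The obstruction of §3 lives at times where the Type-I ratio `(T-t)V²/ν` exceeds `K²` along the witness times
(in the family, `(1-t)·V² = (1-t)⁻⁵ → ∞`).  Conversely, a level-`K` witness requested at a time where the speed bound
obeys the Type-I-type inequality `(T-t)V² ≤ K²ν` is automatically late, by the Reynolds clause alone.  So the
lateness residual of the anchor stubs is exactly a statement about witnesses at STRICTLY TYPE-II TIMES. -/

/-- **Lateness is free in the Type-I window.**  If the Reynolds clause `Kν ≤ LV` of a level-`K` witness holds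
(`K ≥ 0`, `V > 0`) and the speed bound satisfies `(T - t)·V² ≤ K²·ν` (Type-I ratio at most `K²` at the witness
time), then the witness is late: `(T - t)·V ≤ K·L`.  (`(T-t)V = (T-t)V²/V ≤ K²ν/V ≤ K·LV/V`.) [folklore] -/
theorem late_of_typeI_window {ν K L V T t : ℝ} (hK : 0 ≤ K) (hV : 0 < V) (hRe : K * ν ≤ L * V)
    (hI : (T - t) * V ^ 2 ≤ K ^ 2 * ν) : (T - t) * V ≤ K * L := by
  have h1 : K ^ 2 * ν ≤ K * L * V := by
    calc K ^ 2 * ν = K * (K * ν) := by ring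
      _ ≤ K * (L * V) := mul_le_mul_of_nonneg_left hRe hK
      _ = K * L * V := by ring
  nlinarith

/-- **A non-late witness sits at a strictly Type-II time** (contrapositive of `late_of_typeI_window`): if the
Reynolds clause holds and the witness is NOT late, `K·L < (T - t)·V`, then `K²·ν < (T - t)·V²` — the Type-I ratio
at the witness time exceeds `K²`.  In particular the lateness residual of the anchor stubs concerns only witnesses
at times where the blow-up is beyond the Type-I rate at their own level. [folklore] -/
theorem typeII_of_not_late {ν K L V T t : ℝ} (hK : 0 ≤ K) (hV : 0 < V) (hRe : K * ν ≤ L * V)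
    (hlate : K * L < (T - t) * V) : K ^ 2 * ν < (T - t) * V ^ 2 := by
  by_contra h
  push Not at h
  exact absurd (late_of_typeI_window hK hV hRe h) (not_le.2 hlate)

end CoreExclusionAnchorObstruction

end Summit.NavierStokesRegularity.NavierStokesRegularity.Theorems

end
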